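import Mathlib
import Literature.Analysis.FluidPDE.Tao2016AveragedNS.ShiftSetCascadeFlows
import Literature.Analysis.FluidPDE.Tao2016AveragedNS.ShiftSetCascadeFlux
import Summits.NavierStokesRegularity.NavierStokesRegularity.Theorems.TaoLadderRungTwoFlatQuadPolarOn
import Summits.NavierStokesRegularity.NavierStokesRegularity.Theorems.TaoLadderRungTwoFlatLinearisedUniqueness
import Summits.NavierStokesRegularity.NavierStokesRegularity.Theorems.TaoLadderRungTwoFlatPulseDefs
import Summits.NavierStokesRegularity.NavierStokesRegularity.Theorems.TaoLadderRungTwoFlatGaugeGronwall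
import Summits.NavierStokesRegularity.NavierStokesRegularity.Theorems.TaoLadderRungTwoFlatNonlinearHop
import Summits.NavierStokesRegularity.NavierStokesRegularity.Theorems.TaoLadderRungTwoFlatHopRenormalisation
import Summits.NavierStokesRegularity.NavierStokesRegularity.Theorems.TaoLadderRungTwoFlatGaugeGronwallOn
import Summits.NavierStokesRegularity.NavierStokesRegularity.Theorems.TaoLadderRungTwoFlatNonlinearHopOn
import HarnessLib

/-!
# HOP RE-NORMALISATION ON A TIME WINDOW (read-out at an interior time `T_r`, margin `δ₀`)
  (helper for item stmt-NavierStokesRegularity-22987 `FlatGapCertificatesV2`, crux K_A♭ of route TaoLadderRungTwoFlat;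
  cell harvest/h2-tao-ladder, p1 g20 — window version of `…HopRenormalisation.hop_renormalisation` for graded
  certificate flows, which exist on windows `[0, T]` only; the re-normalised reference time `T_r + h`, `|h| ≤ 2CB ≤ δ₀`,
  must stay inside the window, hence the margins `0 < T_r − δ₀`, `T_r + δ₀ < T`)

* `abs_taylor_two_le_Icc` — second-order Taylor bound from derivatives on the segment only;
* `gauge_abs_taylor_le_Icc` — `w|W(T_r + h) − W(T_r) − h·Q(W)(T_r)| ≤ 2‖α‖₁²A²M_w³h²` for a window solution with
  `w|W| ≤ M_w` on `[T_r − δ₀, T_r + δ₀] ⊆ (0, T)`;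
* `hop_renormalisation_Icc` — **∃ κ h, |κ − 1| ≤ CB, |h| ≤ 2CB,
  `ω_{i,k}|X_{i,k+N}(T_r) − κW_{i,k+N}(T_r + h)| ≤ ρB + Γ(‖α‖₁A(B̃e^{L'T})²T_re^{L'T_r} + 12C²B²‖α‖₁²A²M_w³)`**
  under the window hypotheses of `nonlinear_hop_estimate_Icc` with the (S2) directions at `T_r`.

HONEST FRAMING: elementary perturbation theory for MODEL lattices; nothing certified; nothing about the Navier–Stokes
equations.
-/

noncomputable section

-- the sub-problem namespace repeats the summit name by design (D-0017)
set_option linter.dupNamespace false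

namespace Summit.NavierStokesRegularity.NavierStokesRegularity.Theorems

open Set Filter Literature.Analysis.FluidPDE Literature.Analysis.FluidPDE.TaoCascade
open scoped Topology Nat

namespace QuadPolar

variable {m : ℕ}

/-- **Second-order Taylor bound from derivatives on the segment**: `HasDerivAt f (f' s) s` and
`|f'(s) − f'(T)| ≤ G|s − T|` for `s ∈ [T − |h|, T + |h|]` (`G ≥ 0`) give `|f(T+h) − f(T) − h f'(T)| ≤ G h²`. [folklore] -/
theorem abs_taylor_two_le_Icc {f f' : ℝ → ℝ} {T h G : ℝ} (hG : 0 ≤ G)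
    (hf : ∀ s ∈ Icc (T - |h|) (T + |h|), HasDerivAt f (f' s) s)
    (hlip : ∀ s ∈ Icc (T - |h|) (T + |h|), |f' s - f' T| ≤ G * |s - T|) :
    |f (T + h) - f T - h * f' T| ≤ G * h ^ 2 := by
  have hseg : ∀ s ∈ uIcc T (T + h), s ∈ Icc (T - |h|) (T + |h|) := by
    intro s hs
    rcases le_or_gt 0 h with hh | hh
    · rw [uIcc_of_le (by linarith)] at hs
      rw [abs_of_nonneg hh]
      exact ⟨by linarith [hs.1], hs.2⟩
    · rw [uIcc_of_ge (by linarith)] at hs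
      rw [abs_of_neg hh]
      exact ⟨by linarith [hs.1], by linarith [hs.2]⟩
  have hder : ∀ s ∈ uIcc T (T + h),
      HasDerivWithinAt (fun s => f s - s * f' T) (f' s - f' T) (uIcc T (T + h)) s := by
    intro s hs
    have h1 : HasDerivAt (fun s => f s - s * f' T) (f' s - 1 * f' T) s :=
      (hf s (hseg s hs)).sub ((hasDerivAt_id s).mul_const _)
    rw [one_mul] at h1
    exact h1.hasDerivWithinAt
  have hbound : ∀ s ∈ uIcc T (T + h), ‖f' s - f' T‖ ≤ G * |h| := by
    intro s hs
    have hs' := hseg s hs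
    have hsT : |s - T| ≤ |h| := by
      rw [abs_le]; constructor <;> linarith [hs'.1, hs'.2]
    rw [Real.norm_eq_abs]
    exact (hlip s hs').trans (mul_le_mul_of_nonneg_left hsT hG)
  have hmv := Convex.norm_image_sub_le_of_norm_hasDerivWithin_le hder hbound (convex_uIcc T (T + h))
    left_mem_uIcc right_mem_uIcc
  have e : (f (T + h) - (T + h) * f' T) - (f T - T * f' T) = f (T + h) - f T - h * f' T := by ring
  rw [e, Real.norm_eq_abs] at hmv
  calc |f (T + h) - f T - h * f' T| ≤ G * |h| * ‖T + h - T‖ := hmv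
    _ = G * h ^ 2 := by rw [add_sub_cancel_left, Real.norm_eq_abs, mul_assoc, ← sq, sq_abs]

/-- **Gauge Taylor bound for a WINDOW solution**: `W` solves the lattice on `Ioo 0 T`; `[T_r − δ₀, T_r + δ₀] ⊆ (0, T)`;
`w|W| ≤ M_w` there; `|h| ≤ δ₀`. Then `w_{i,n}|W(T_r + h) − W(T_r) − h·Q(W)(T_r)|_{i,n} ≤ 2‖α‖₁²A²M_w³·h²`.
[cite: Tao2016AveragedNS, §4 (4.8); folklore] -/
theorem gauge_abs_taylor_le_Icc {𝕊 : Finset (ℤ × ℤ × ℤ)} (h𝕊 : IsNearestNeighbourSet 𝕊)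
    (α : Fin m → Fin m → Fin m → ℤ × ℤ × ℤ → ℝ) {w : Fin m → ℤ → ℝ} {A : ℝ} (hwpos : ∀ i n, 0 < w i n)
    (hA : IsWindowAdmissible w A) {W : Fin m → ℤ → ℝ → ℝ} {Mw T Tr δ₀ h : ℝ} (hMw : 0 ≤ Mw)
    (hW : ∀ i n, ∀ t ∈ Ioo 0 T, HasDerivAt (W i n) (quadTermOn 𝕊 0 α W i n t) t)
    (hlo : 0 < Tr - δ₀) (hhi : Tr + δ₀ < T)
    (hWg : ∀ j k, ∀ t ∈ Icc (Tr - δ₀) (Tr + δ₀), w j k * |W j k t| ≤ Mw) (hh : |h| ≤ δ₀) (i : Fin m) (n : ℤ) :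
    w i n * |W i n (Tr + h) - W i n Tr - h * quadTermOn 𝕊 0 α W i n Tr| ≤
      2 * (tableAbsSum 𝕊 α) ^ 2 * A ^ 2 * Mw ^ 3 * h ^ 2 := by
  have hw0 : 0 < w i n := hwpos i n
  set G : ℝ := 2 * (tableAbsSum 𝕊 α) ^ 2 * A ^ 2 * Mw ^ 3 with hG
  have hG0 : 0 ≤ G := by rw [hG]; have := hA.1; positivity
  have hin : ∀ s ∈ Icc (Tr - δ₀) (Tr + δ₀), s ∈ Ioo 0 T := fun s hs =>
    ⟨hlo.trans_le hs.1, hs.2.trans_lt hhi⟩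
  have hsub : Icc (Tr - |h|) (Tr + |h|) ⊆ Icc (Tr - δ₀) (Tr + δ₀) := Icc_subset_Icc (by linarith) (by linarith)
  -- Ẇ = Q(W) has derivative Lin_W(Q(W)) at every time of the margin interval, gauge-bounded by G
  have hQd : ∀ s ∈ Icc (Tr - δ₀) (Tr + δ₀), HasDerivAt (fun s => quadTermOn 𝕊 0 α W i n s)
      (linTermOn 𝕊 0 α W (fun j k s => quadTermOn 𝕊 0 α W j k s) i n s) s := fun s hs =>
    MirrorPulse.hasDerivAt_quadTermOn 𝕊 0 α (fun j k => hW j k s (hin s hs)) i n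
  have hlipQ : ∀ s ∈ Icc (Tr - |h|) (Tr + |h|),
      |quadTermOn 𝕊 0 α W i n s - quadTermOn 𝕊 0 α W i n Tr| ≤ G / w i n * |s - Tr| := by
    intro s hs
    have hs' := hsub hs
    have hTr' : Tr ∈ Icc (Tr - δ₀) (Tr + δ₀) := ⟨by linarith [abs_nonneg h], by linarith [abs_nonneg h]⟩
    have hseg : uIcc Tr s ⊆ Icc (Tr - δ₀) (Tr + δ₀) := by
      intro x hx
      rcases le_or_gt Tr s with hTs | hTs
      · rw [uIcc_of_le hTs] at hx; exact ⟨by linarith [hx.1, hTr'.1], by linarith [hx.2, hs'.2]⟩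
      · rw [uIcc_of_ge hTs.le] at hx; exact ⟨by linarith [hx.1, hs'.1], by linarith [hx.2, hTr'.2]⟩
    have hb : ∀ x ∈ uIcc Tr s, ‖linTermOn 𝕊 0 α W (fun j k s => quadTermOn 𝕊 0 α W j k s) i n x‖ ≤ G / w i n := by
      intro x hx
      rw [Real.norm_eq_abs, le_div_iff₀ hw0, mul_comm]
      exact gauge_abs_accel_le h𝕊 α hwpos hA hMw (fun j k => hWg j k x (hseg hx)) i n
    have hmv := Convex.norm_image_sub_le_of_norm_hasDerivWithin_le
      (fun x hx => (hQd x (hseg hx)).hasDerivWithinAt) hb (convex_uIcc Tr s) left_mem_uIcc right_mem_uIcc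
    rw [Real.norm_eq_abs, Real.norm_eq_abs] at hmv
    exact hmv
  have ht := abs_taylor_two_le_Icc (f := W i n) (f' := fun s => quadTermOn 𝕊 0 α W i n s) (T := Tr)
    (by positivity) (fun s hs => hW i n s (hin s (hsub hs))) hlipQ
  calc w i n * |W i n (Tr + h) - W i n Tr - h * quadTermOn 𝕊 0 α W i n Tr| ≤ w i n * (G / w i n * h ^ 2) :=
        mul_le_mul_of_nonneg_left ht hw0.le
    _ = G * h ^ 2 := by field_simp

/-- **HOP RE-NORMALISATION ON A WINDOW.** Window solutions `W`, `X` on `[0, T]` (bounded by `M`), read-out time `T_r` with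
margin `δ₀` (`0 < T_r − δ₀`, `T_r + δ₀ < T`, `2CB ≤ δ₀`), the (S2)-shape linear hypothesis over window variational solutions
read at `T_r` with directions `Q(W)_{·+N}(T_r)`, `W_{·+N}(T_r)`, gauges as in `nonlinear_hop_estimate_Icc`, and
`w|W| ≤ M_w` on `[T_r − δ₀, T_r + δ₀]`. Then ∃ `κ = 1 + c₂`, `h = c₁/κ` with `|κ − 1| ≤ CB`, `|h| ≤ 2CB` and
`ω_{i,k}|X_{i,k+N}(T_r) − κW_{i,k+N}(T_r + h)| ≤ ρB + Γ(‖α‖₁A(B̃e^{L'T})²T_re^{L'T_r} + 12C²B²‖α‖₁²A²M_w³)`.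
[cite: Tao2016AveragedNS, §4 (4.8) and §6.3–6.4 (statement shape); route TaoLadderRungTwoFlat, analytic lane L3 on certificate windows] -/
theorem hop_renormalisation_Icc {𝕊 : Finset (ℤ × ℤ × ℤ)} (h𝕊 : IsNearestNeighbourSet 𝕊)
    (α : Fin m → Fin m → Fin m → ℤ × ℤ × ℤ → ℝ) {w ω : Fin m → ℤ → ℝ} {Λ A Γ : ℝ} (hw : IsWindowRegular w Λ)
    (hA : IsWindowAdmissible w A) (hω : ∀ i k, 0 ≤ ω i k) {N : ℤ} (hΓ : ∀ i k, ω i k ≤ Γ * w i (k + N))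
    {W X : Fin m → ℤ → ℝ → ℝ} {M Mw T Tr δ₀ ρ C B B' : ℝ} (hTr : Tr ∈ Icc 0 T) (hMw : 0 ≤ Mw)
    (hlo : 0 < Tr - δ₀) (hhi : Tr + δ₀ < T) (hCBδ : 2 * (C * B) ≤ δ₀) (hCB : C * B ≤ 1 / 2)
    (hWc : ∀ i n, ContinuousOn (W i n) (Icc 0 T)) (hXc : ∀ i n, ContinuousOn (X i n) (Icc 0 T))
    (hW : ∀ i n, ∀ t ∈ Ioo 0 T, HasDerivAt (W i n) (quadTermOn 𝕊 0 α W i n t) t)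
    (hX : ∀ i n, ∀ t ∈ Ioo 0 T, HasDerivAt (X i n) (quadTermOn 𝕊 0 α X i n t) t)
    (hWb : ∀ i n, ∀ t ∈ Icc 0 T, |W i n t| ≤ M) (hXb : ∀ i n, ∀ t ∈ Icc 0 T, |X i n t| ≤ M)
    (hWg : ∀ j k, ∀ t ∈ Icc (Tr - δ₀) (Tr + δ₀), w j k * |W j k t| ≤ Mw)
    (hlin : ∀ u : Fin m → ℤ → ℝ → ℝ, (∀ i n, ContinuousOn (u i n) (Icc 0 T)) →
      (∀ i n, ∀ t ∈ Ioo 0 T, HasDerivAt (u i n) (linTermOn 𝕊 0 α W u i n t) t) →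
      (∃ Mu : ℝ, ∀ i n, ∀ t ∈ Icc 0 T, |u i n t| ≤ Mu) → (∀ i k, ω i k * |u i k 0| ≤ B) →
        ∃ c₁ c₂ : ℝ, |c₁| ≤ C * B ∧ |c₂| ≤ C * B ∧
          ∀ i k, ω i k * |u i (k + N) Tr - c₁ * quadTermOn 𝕊 0 α W i (k + N) Tr - c₂ * W i (k + N) Tr| ≤ ρ * B)
    (hB : ∀ i k, ω i k * |X i k 0 - W i k 0| ≤ B) (hB' : ∀ i k, w i k * |X i k 0 - W i k 0| ≤ B') :
    ∃ κ h : ℝ, |κ - 1| ≤ C * B ∧ |h| ≤ 2 * (C * B) ∧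
      ∀ i k, ω i k * |X i (k + N) Tr - κ * W i (k + N) (Tr + h)| ≤
        ρ * B + Γ * (tableAbsSum 𝕊 α * A * (B' * Real.exp (2 * tableAbsSum 𝕊 α * M * Λ * T)) ^ 2 * Tr *
          Real.exp (2 * tableAbsSum 𝕊 α * M * Λ * Tr) + 12 * (C * B) ^ 2 * ((tableAbsSum 𝕊 α) ^ 2 * A ^ 2 * Mw ^ 3)) := by
  obtain ⟨c₁, c₂, hc₁, hc₂, hest⟩ := nonlinear_hop_estimate_Icc h𝕊 α hw hA hω hΓ hTr hWc hXc hW hX hWb hXb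
    (v₁ := fun i k => quadTermOn 𝕊 0 α W i (k + N) Tr) (v₂ := fun i k => W i (k + N) Tr) hlin hB hB'
  set κ : ℝ := 1 + c₂ with hκ
  have hc₂' : |c₂| ≤ 1 / 2 := hc₂.trans hCB
  have hκlo : 1 / 2 ≤ κ := by rw [hκ]; linarith [(abs_le.mp hc₂').1]
  have hκhi : κ ≤ 3 / 2 := by rw [hκ]; linarith [(abs_le.mp hc₂').2]
  have hκpos : 0 < κ := by linarith
  set h : ℝ := c₁ / κ with hh
  have hhabs : |h| ≤ 2 * (C * B) := by
    rw [hh, abs_div, abs_of_pos hκpos, div_le_iff₀ hκpos]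
    nlinarith [hc₁, abs_nonneg c₁]
  have hhδ : |h| ≤ δ₀ := hhabs.trans hCBδ
  refine ⟨κ, h, by rw [hκ]; simpa using hc₂, hhabs, fun i k => ?_⟩
  set E₁ : ℝ := tableAbsSum 𝕊 α * A * (B' * Real.exp (2 * tableAbsSum 𝕊 α * M * Λ * T)) ^ 2 * Tr *
    Real.exp (2 * tableAbsSum 𝕊 α * M * Λ * Tr) with hE₁
  set G : ℝ := (tableAbsSum 𝕊 α) ^ 2 * A ^ 2 * Mw ^ 3 with hG
  have hwpos := hw.1
  have hw0 : 0 < w i (k + N) := hwpos i (k + N)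
  have hΓ0 : 0 ≤ Γ := by
    have h1 := (hω i k).trans (hΓ i k)
    by_contra hneg
    push Not at hneg
    have : Γ * w i (k + N) < 0 := mul_neg_of_neg_of_pos hneg hw0
    linarith
  have h1 := hest i k
  have htay := gauge_abs_taylor_le_Icc h𝕊 α hwpos hA hMw hW hlo hhi hWg hhδ i (k + N)
  have h2 : ω i k * |κ * (W i (k + N) (Tr + h) - W i (k + N) Tr - h * quadTermOn 𝕊 0 α W i (k + N) Tr)| ≤
      Γ * (12 * (C * B) ^ 2 * G) := by
    rw [abs_mul, abs_of_pos hκpos]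
    have hh2 : h ^ 2 ≤ (2 * (C * B)) ^ 2 := by
      have := hhabs; rw [← sq_abs]; exact pow_le_pow_left₀ (abs_nonneg _) this 2
    have hG0 : 0 ≤ G := by rw [hG]; have := hA.1; positivity
    calc ω i k * (κ * |W i (k + N) (Tr + h) - W i (k + N) Tr - h * quadTermOn 𝕊 0 α W i (k + N) Tr|)
        ≤ Γ * w i (k + N) * (κ * |W i (k + N) (Tr + h) - W i (k + N) Tr - h * quadTermOn 𝕊 0 α W i (k + N) Tr|) :=
          mul_le_mul_of_nonneg_right (hΓ i k) (by positivity)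
      _ = Γ * κ * (w i (k + N) * |W i (k + N) (Tr + h) - W i (k + N) Tr - h * quadTermOn 𝕊 0 α W i (k + N) Tr|) := by
          ring
      _ ≤ Γ * κ * (2 * G * h ^ 2) := by
          refine mul_le_mul_of_nonneg_left ?_ (by positivity)
          calc w i (k + N) * |W i (k + N) (Tr + h) - W i (k + N) Tr - h * quadTermOn 𝕊 0 α W i (k + N) Tr|
              ≤ 2 * (tableAbsSum 𝕊 α) ^ 2 * A ^ 2 * Mw ^ 3 * h ^ 2 := htay
            _ = 2 * G * h ^ 2 := by rw [hG]; ring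
      _ ≤ Γ * (3 / 2) * (2 * G * (2 * (C * B)) ^ 2) := by
          have h0 : 0 ≤ 2 * G * h ^ 2 := by positivity
          have h3 : 2 * G * h ^ 2 ≤ 2 * G * (2 * (C * B)) ^ 2 := mul_le_mul_of_nonneg_left hh2 (by positivity)
          calc Γ * κ * (2 * G * h ^ 2) ≤ Γ * (3 / 2) * (2 * G * h ^ 2) :=
                mul_le_mul_of_nonneg_right (mul_le_mul_of_nonneg_left hκhi hΓ0) h0
            _ ≤ Γ * (3 / 2) * (2 * G * (2 * (C * B)) ^ 2) := mul_le_mul_of_nonneg_left h3 (by positivity)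
      _ = Γ * (12 * (C * B) ^ 2 * G) := by ring
  have hκh : κ * h = c₁ := by rw [hh]; field_simp
  have e : X i (k + N) Tr - κ * W i (k + N) (Tr + h) =
      (X i (k + N) Tr - W i (k + N) Tr - c₁ * quadTermOn 𝕊 0 α W i (k + N) Tr - c₂ * W i (k + N) Tr) -
        κ * (W i (k + N) (Tr + h) - W i (k + N) Tr - h * quadTermOn 𝕊 0 α W i (k + N) Tr) := by
    linear_combination (-(W i (k + N) Tr)) * hκ + (-(quadTermOn 𝕊 0 α W i (k + N) Tr)) * hκh
  rw [e]
  calc ω i k * |(X i (k + N) Tr - W i (k + N) Tr - c₁ * quadTermOn 𝕊 0 α W i (k + N) Tr - c₂ * W i (k + N) Tr) -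
        κ * (W i (k + N) (Tr + h) - W i (k + N) Tr - h * quadTermOn 𝕊 0 α W i (k + N) Tr)|
      ≤ ω i k * (|X i (k + N) Tr - W i (k + N) Tr - c₁ * quadTermOn 𝕊 0 α W i (k + N) Tr - c₂ * W i (k + N) Tr| +
          |κ * (W i (k + N) (Tr + h) - W i (k + N) Tr - h * quadTermOn 𝕊 0 α W i (k + N) Tr)|) :=
        mul_le_mul_of_nonneg_left (abs_sub _ _) (hω i k)
    _ = ω i k * |X i (k + N) Tr - W i (k + N) Tr - c₁ * quadTermOn 𝕊 0 α W i (k + N) Tr - c₂ * W i (k + N) Tr| +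
          ω i k * |κ * (W i (k + N) (Tr + h) - W i (k + N) Tr - h * quadTermOn 𝕊 0 α W i (k + N) Tr)| := by ring
    _ ≤ (ρ * B + Γ * E₁) + Γ * (12 * (C * B) ^ 2 * G) := add_le_add h1 h2
    _ = ρ * B + Γ * (E₁ + 12 * (C * B) ^ 2 * G) := by ring

end QuadPolar

end Summit.NavierStokesRegularity.NavierStokesRegularity.Theorems

end
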